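import Summits.AtomisticToContinuum.BoseEinsteinCondensation.Theses.BECCovarianceTransport

/-!
# Birth skeleton (BC3) for crux `SoftShellRelaxation` — stmt-AtomisticToContinuum-12684
(route `BECCovarianceTransport`, rank 3; sub-problem `BoseEinsteinCondensation`)

Planner `planner-skel-stmt-AtomisticToContinuum-12684-0`, 2026-08-17 (skeleton-register, re-audit bin
REPAIRABLE). Published as `Cruxes/SoftShellRelaxation/Lines/birth.lean`.

The crux: SHELL RELAXATION STATISTICS of the torus imaginary-time Feynman–Kac flow `Φ_t = e^{-tH}1`
(`N = M + 2` particles, `L = (N/ρ)^{1/3}`, `c = √(16πρa)`, `κ = 1/ξ = √(8πρa)`): for every dyadic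
plane-wave shell `B_j = {n : k_j/2 < |k_n| ≤ k_j}`, `k_j = 2⁻ʲκ`, every finite `S ⊆ B_j` and all
`t ≥ C/(ck_j)` — `⟨N_S⟩_t ≤ C L³ck_j²` (occupation) and `⟨N_S²⟩_t − ⟨N_S⟩_t² ≤ C L³c²k_j` (number
variance), uniformly in `L`.

The skeleton cuts the crux along the seam foreseen in the route's two-layer plan ("(occupation half) →
(variance half)"), with the occupation half SHARPENED to its natural per-mode form, so that the two
stubs are the two physical laws and the shell geometry is proved here:

* `stub_modeOccupation : ModeOccupationLaw` — the Bogoliubov / Gavoret–Nozières INFRARED LAW for the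
  flow state, mode by mode: a plane wave of momentum `0 < |k_n| ≤ κ` carries `≤ C·c/|k_n|` particles
  for all `t ≥ C/(c|k_n|)`, uniformly in `L` (Bogoliubov value `v_k² = (k² + c²/2 − ω_k)/(2ω_k) ≈ c/(4k)`,
  reached monotonically from `0` along the flow of the particle vacuum at one loop: refuter evidence
  `GaussianEvidence.md` / `toy_bogoliubov_bundle.txt` on the item). Size XL (thermodynamic-limit
  momentum-distribution bound down to `k = 2π/L`; nothing of the kind in print — Fournais2020 Thm 1.2 and
  BrenneckeCaporalettiSchlein2022 only in `ρ`-tied boxes). The hardest stub.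
* `stub_shellVariance : ShellVarianceLaw` — the variance half verbatim: `⟨N_S⟩ + ⟨N_S(N_S−1)⟩ ≤ ⟨N_S⟩² +
  C L³c²k_j` for every finite `S ⊆ B_j`, `t ≥ C/(ck_j)` — approximate independence of the `∼ (Lk_j)³`
  distinct momentum pairs of a relaxed shell (per `±k` pair the quasi-free variance is `4u²v² ≈ (c/2k)²`);
  the correlated, genuinely many-mode statement. Size XL.
* `card_le_of_norm_le` (PROVED) — lattice-point count: a finite set of nonzero `n ∈ ℤ³` with `|n| ≤ R`
  has at most `27R³` elements (`S ⊆ [−⌊R⌋, ⌊R⌋]³`, `(2⌊R⌋+1)³ ≤ (3R)³` as `R ≥ 1`).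
* `SoftShellRelaxation_of` (PROVED, no `sorry`) — the assembly: `C := max (54 C₁) C₂`, `ρ₀ := min ρ₁ ρ₂`,
  eventual ranges intersected; for `n ∈ S ⊆ B_j` one has `0 < k_j/2 < |k_n| ≤ k_j ≤ κ`, so the per-mode
  threshold `C₁/(c|k_n|) ≤ 2C₁/(ck_j) ≤ C/(ck_j) ≤ t` fires and `⟨N_S⟩_t = Σ_{n∈S} ⟨N_{{n}}⟩_t ≤
  #S · 2C₁c/k_j ≤ 27(Lk_j)³ · 2C₁c/k_j = 54 C₁ L³ck_j²` (using `|n| ≤ Lk_j/(2π) ≤ Lk_j`); the variance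
  half is monotone in `C` because `L > 0`. Hypotheses are spelled `__Registered.stub_X` (`rfl`-aliases of
  the two statements keyed by the stub names, the device of `Cruxes/AmplitudeLDP/Lines/birth.lean`, so
  that the native `#h21_check_skeleton` admits them); the conclusion is the route decl
  `Summit.AtomisticToContinuum.BoseEinsteinCondensation.Theses.BECCovarianceTransport.SoftShellRelaxation`
  BY NAME.

Disproof used: none relevant — no `Cruxes/SoftShellRelaxation/Disproof.lean`, no landed
`Theorems/SoftShellRelaxation/Negative/*`, no workfiles at all on 2026-08-17 (`ledger crux ls`); the
refuter crux-attack of 2026-08-15 (evidence `EVIDENCE_12684.md`) found the crux surviving, degenerate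
cases benign (`a = 0 ⇒ κ = 0 ⇒` every shell empty; `S = ∅ ⇒ occ = pair = 0`; `n = 0` never in a
shell) — the same degenerate cases are discharged uniformly in `SoftShellRelaxation_of` (`k_j = 0`
makes the shell hypothesis contradictory, `n = 0` is excluded by `|k_n| > 0`).

BC3 audit (planner folder `bc/`, 2026-08-17, farm `lean check --json`): this file rc 0, errors [],
sorries 2 = the two `stub_*` (the two `declaration uses sorry` warnings sit exactly at
`stub_modeOccupation` and `stub_shellVariance`; zero elsewhere), `#print axioms SoftShellRelaxation_of` =
[propext, Classical.choice, Quot.sound] (no `sorryAx`). Probes (files `bc/<Stub>_probe.lean`, stub def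
copied verbatim, 10 examples each: `S → SoftShellRelaxation` and `S → _root_.BoseEinsteinCondensation` by
the combined `first | exact? | simpa [S] | (unfold S; simpa) | aesop` and by each alternative alone,
`maxHeartbeats 400000`): 20/20 FAIL — `exact?` "could not close the goal", `simpa [S]` / `unfold S;
simpa` "Tactic `assumption` failed", `aesop` "failed to prove the goal after exhaustive search" (unsolved
goals), the combined `ShellVarianceLaw → ·` probes exhaust 400000 heartbeats at `whnf`. No stub is cheaply
the crux or the summit (no shredding / costume).
-/

noncomputable section

namespace Summit.AtomisticToContinuum.BoseEinsteinCondensation.Cruxes.SoftShellRelaxation.Birth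

open MeasureTheory Filter
open scoped ENNReal NNReal ComplexConjugate BigOperators
open Literature.MathematicalPhysics.QuantumManyBody
open Literature.MathematicalPhysics.QuantumManyBody.BoseGas
open Summit.AtomisticToContinuum.BoseEinsteinCondensation.Theses.BECCovarianceTransport

/-! ## Stub statements (the crux's own `let`-vocabulary, symbol for symbol) -/

/-- **Stub A — per-mode infrared occupation law along the torus flow.** For admissible `v` there are
`C, ρ₀ > 0` such that for `0 < ρ < ρ₀` and all large `M` (`N = M + 2` particles, `L = (N/ρ)^{1/3}`,
`c = √(16πρa)`, `κ = √(8πρa)`, `Φ_t` the Feynman–Kac flow of the constant, `Z(t) = ∫_{cell^N} Φ_t²`):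
every plane-wave mode `n ∈ ℤ³` with `0 < |k_n| ≤ κ` (`|k_n| = 2π|n|/L`) has normalised occupation
`⟨N_{{n}}⟩_t ≤ C · c/|k_n|` for all `t ≥ C/(c|k_n|)` — the Bogoliubov/Gavoret–Nozières `n_k ≈ c/(4k)`
law of the soft modes, uniformly in `L` and in `t` beyond the mode's own relaxation time. -/
def ModeOccupationLaw : Prop :=
  ∀ v : ℝ → ℝ≥0∞, IsRepulsiveFiniteRange v → ∃ C ρ₀ : ℝ, 0 < C ∧ 0 < ρ₀ ∧
    ∀ ρ : ℝ, 0 < ρ → ρ < ρ₀ → ∀ᶠ M : ℕ in Filter.atTop,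
      let L : ℝ := sideLength ρ (M + 2)
      let a : ℝ := (scatteringLength v).toReal
      let c : ℝ := Real.sqrt (16 * Real.pi * ρ * a)
      let κ : ℝ := Real.sqrt (8 * Real.pi * ρ * a)
      let Φ : ℝ → Config (M + 2) → ℝ≥0∞ := fun t X =>
        ∫⁻ ω, expNeg (∫⁻ s in Set.Ioc (0 : ℝ) t, periodicInteraction v L (worldLine X ω s.toNNReal))
          ∂(wienerPaths (M + 2))
      let Z : ℝ → ℝ≥0∞ := fun t => ∫⁻ X in cellN (M + 2) L, Φ t X ^ 2
      let mode : (Fin 3 → ℤ) → EuclideanSpace ℝ (Fin 3) → ℂ := fun n x =>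
        ((Real.sqrt (L ^ 3))⁻¹ : ℂ) * cellWave L n x
      let kn : (Fin 3 → ℤ) → ℝ := fun n =>
        2 * Real.pi * Real.sqrt (∑ k : Fin 3, ((n k : ℤ) : ℝ) ^ 2) / L
      let occ : Finset (Fin 3 → ℤ) → ℝ → ℝ≥0∞ := fun S t =>
        (∑ n ∈ S, cellOccupation (M + 2) L (mode n) (fun X => ((Φ t X).toReal : ℂ))) / Z t
      ∀ n : Fin 3 → ℤ, 0 < kn n → kn n ≤ κ → ∀ t : ℝ, C * (c * kn n)⁻¹ ≤ t →
        occ {n} t ≤ ENNReal.ofReal (C * c / kn n)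

/-- **Stub B — shell number-variance law along the torus flow (the crux's variance half).** Same
flow and vocabulary, with the two-body pair occupation `pair S t = (M+2)(M+1) Σ_{n,m∈S} ∫_{cell^M}
|⟨e_n ⊗ e_m, Φ_t(·,·,Y)⟩|² dY / Z(t)` (so `⟨N_S²⟩ = occ + pair`): for every dyadic shell index `j`
(`k_j = 2⁻ʲκ`), every finite `S ⊆ B_j = {k_j/2 < |k_n| ≤ k_j}` and all `t ≥ C/(ck_j)`:
`Var_t(N_S) = ⟨N_S⟩ + pair − ⟨N_S⟩² ≤ C L³c²k_j` (quasi-free value `#pairs · 4u²v² ∼ L³c²k_j`). -/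
def ShellVarianceLaw : Prop :=
  ∀ v : ℝ → ℝ≥0∞, IsRepulsiveFiniteRange v → ∃ C ρ₀ : ℝ, 0 < C ∧ 0 < ρ₀ ∧
    ∀ ρ : ℝ, 0 < ρ → ρ < ρ₀ → ∀ᶠ M : ℕ in Filter.atTop,
      let L : ℝ := sideLength ρ (M + 2)
      let a : ℝ := (scatteringLength v).toReal
      let c : ℝ := Real.sqrt (16 * Real.pi * ρ * a)
      let κ : ℝ := Real.sqrt (8 * Real.pi * ρ * a)
      let Φ : ℝ → Config (M + 2) → ℝ≥0∞ := fun t X =>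
        ∫⁻ ω, expNeg (∫⁻ s in Set.Ioc (0 : ℝ) t, periodicInteraction v L (worldLine X ω s.toNNReal))
          ∂(wienerPaths (M + 2))
      let Z : ℝ → ℝ≥0∞ := fun t => ∫⁻ X in cellN (M + 2) L, Φ t X ^ 2
      let mode : (Fin 3 → ℤ) → EuclideanSpace ℝ (Fin 3) → ℂ := fun n x =>
        ((Real.sqrt (L ^ 3))⁻¹ : ℂ) * cellWave L n x
      let kn : (Fin 3 → ℤ) → ℝ := fun n =>
        2 * Real.pi * Real.sqrt (∑ k : Fin 3, ((n k : ℤ) : ℝ) ^ 2) / L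
      let occ : Finset (Fin 3 → ℤ) → ℝ → ℝ≥0∞ := fun S t =>
        (∑ n ∈ S, cellOccupation (M + 2) L (mode n) (fun X => ((Φ t X).toReal : ℂ))) / Z t
      let pair : Finset (Fin 3 → ℤ) → ℝ → ℝ≥0∞ := fun S t =>
        ((M + 2 : ℝ≥0∞) * (M + 1)) *
          (∑ n ∈ S, ∑ m ∈ S, ∫⁻ Y in cellN M L,
            (‖∫ x in cell L, ∫ y in cell L, conj (mode n x) * conj (mode m y) *
              ((Φ t (Matrix.vecCons x (Matrix.vecCons y Y))).toReal : ℂ)‖₊ : ℝ≥0∞) ^ 2) / Z t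
      ∀ j : ℕ, ∀ S : Finset (Fin 3 → ℤ),
        (∀ n ∈ S, κ * 2⁻¹ ^ j / 2 < kn n ∧ kn n ≤ κ * 2⁻¹ ^ j) →
        ∀ t : ℝ, C * (c * (κ * 2⁻¹ ^ j))⁻¹ ≤ t →
          occ S t + pair S t ≤ occ S t ^ 2 + ENNReal.ofReal (C * L ^ 3 * c ^ 2 * (κ * 2⁻¹ ^ j))

/-! ## Registered stubs -/

/-- stub A: the per-mode infrared occupation law (hardest stub; the open core of the occupation half). -/
theorem stub_modeOccupation : ModeOccupationLaw := by
  sorry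

/-- stub B: the shell number-variance law (the crux's variance half, verbatim). -/
theorem stub_shellVariance : ShellVarianceLaw := by
  sorry

/-! ## Name-keyed aliases of the two stub statements — the hypotheses of `SoftShellRelaxation_of`

The native skeleton audit (`#h21_check_skeleton`) admits a hypothesis of the skeleton theorem only if its
head constant is a registered obligation or is NAMED like a declared stub; `__Registered.stub_X` is the
statement of `stub_X` under that name (device of `Cruxes/AmplitudeLDP/Lines/birth.lean`). Each alias is
`rfl`-equal to its statement. -/
namespace __Registered

/-- Alias of `ModeOccupationLaw` keyed by the registered stub name. -/
abbrev stub_modeOccupation : Prop := ModeOccupationLaw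
/-- Alias of `ShellVarianceLaw` keyed by the registered stub name. -/
abbrev stub_shellVariance : Prop := ShellVarianceLaw

end __Registered

/-! ## Shell geometry (proved): lattice points of bounded length -/

/-- **Lattice-point count.** A finite set of NONZERO integer vectors `n ∈ ℤ³` of Euclidean length
`≤ R` has at most `27 R³` elements: `S ⊆ [−⌊R⌋, ⌊R⌋]³`, a cube of `(2⌊R⌋+1)³ ≤ (3R)³` points since a
nonzero lattice point forces `R ≥ 1`. [folklore] -/
theorem card_le_of_norm_le {S : Finset (Fin 3 → ℤ)} {R : ℝ} (hR : 0 ≤ R)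
    (hS : ∀ n ∈ S, n ≠ 0 ∧ Real.sqrt (∑ k : Fin 3, ((n k : ℤ) : ℝ) ^ 2) ≤ R) :
    (S.card : ℝ) ≤ 27 * R ^ 3 := by
  rcases S.eq_empty_or_nonempty with rfl | ⟨n₀, hn₀⟩
  · simp only [Finset.card_empty, Nat.cast_zero]
    positivity
  -- every coordinate is bounded by `R`
  have hcoord : ∀ n ∈ S, ∀ i : Fin 3, |((n i : ℤ) : ℝ)| ≤ R := by
    intro n hn i
    have h := (hS n hn).2
    calc |((n i : ℤ) : ℝ)| = Real.sqrt (((n i : ℤ) : ℝ) ^ 2) := (Real.sqrt_sq_eq_abs _).symm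
      _ ≤ Real.sqrt (∑ k : Fin 3, ((n k : ℤ) : ℝ) ^ 2) :=
          Real.sqrt_le_sqrt (Finset.single_le_sum (f := fun k => ((n k : ℤ) : ℝ) ^ 2)
            (fun k _ => sq_nonneg _) (Finset.mem_univ i))
      _ ≤ R := h
  -- a nonzero lattice point forces `R ≥ 1`
  have hR1 : 1 ≤ R := by
    obtain ⟨i, hi⟩ := Function.ne_iff.1 (hS n₀ hn₀).1
    have h1 : (1 : ℤ) ≤ |n₀ i| := Int.one_le_abs hi
    have h2 : (1 : ℝ) ≤ |((n₀ i : ℤ) : ℝ)| := by exact_mod_cast h1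
    exact h2.trans (hcoord n₀ hn₀ i)
  -- the cube `[−m, m]³`, `m = ⌊R⌋₊`
  set m : ℕ := ⌊R⌋₊ with hm
  have hmR : (m : ℝ) ≤ R := Nat.floor_le hR
  have hRm : R < (m : ℝ) + 1 := Nat.lt_floor_add_one R
  have hsub : S ⊆ Fintype.piFinset fun _ : Fin 3 => Finset.Icc (-(m : ℤ)) m := by
    intro n hn
    rw [Fintype.mem_piFinset]
    intro i
    rw [Finset.mem_Icc]
    have h := hcoord n hn i
    rw [abs_le] at h
    have h1 : -((m : ℝ) + 1) < ((n i : ℤ) : ℝ) := by linarith [h.1]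
    have h2 : ((n i : ℤ) : ℝ) < (m : ℝ) + 1 := by linarith [h.2]
    have h1' : -((m : ℤ) + 1) < n i := by exact_mod_cast h1
    have h2' : n i < (m : ℤ) + 1 := by exact_mod_cast h2
    constructor <;> omega
  have hcardT : (Fintype.piFinset fun _ : Fin 3 => Finset.Icc (-(m : ℤ)) m).card = (2 * m + 1) ^ 3 := by
    rw [Fintype.card_piFinset, Finset.prod_const, Finset.card_univ, Fintype.card_fin, Int.card_Icc]
    congr 1
    omega
  have hcardS : S.card ≤ (2 * m + 1) ^ 3 := (Finset.card_le_card hsub).trans_eq hcardT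
  have hcast : (S.card : ℝ) ≤ (2 * (m : ℝ) + 1) ^ 3 := by exact_mod_cast hcardS
  calc (S.card : ℝ) ≤ (2 * (m : ℝ) + 1) ^ 3 := hcast
    _ ≤ (3 * R) ^ 3 := by
        gcongr
        linarith
    _ = 27 * R ^ 3 := by ring

/-! ## Composition: the crux BY NAME from the two stub statements (no `sorry` below) -/

/-- **SoftShellRelaxation_of** — per-mode infrared law (A) × shell geometry (proved) ⟹ the occupation
half; shell variance law (B) ⟹ the variance half; constants merged as `C := max (54 C₁) C₂`,
`ρ₀ := min ρ₁ ρ₂`. Hypotheses = the two stub statements under their registered names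
(`__Registered.stub_X` is `X` by `rfl`); conclusion = the route decl, by name. -/
theorem SoftShellRelaxation_of (hOcc : __Registered.stub_modeOccupation)
    (hVar : __Registered.stub_shellVariance) :
    Summit.AtomisticToContinuum.BoseEinsteinCondensation.Theses.BECCovarianceTransport.SoftShellRelaxation := by
  intro v hv
  obtain ⟨C₁, ρ₁, hC₁, hρ₁, H₁⟩ := hOcc v hv
  obtain ⟨C₂, ρ₂, hC₂, hρ₂, H₂⟩ := hVar v hv
  refine ⟨max (54 * C₁) C₂, min ρ₁ ρ₂, lt_max_of_lt_right hC₂, lt_min hρ₁ hρ₂, ?_⟩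
  intro ρ hρ hρlt
  have E₁ := H₁ ρ hρ (lt_of_lt_of_le hρlt (min_le_left _ _))
  have E₂ := H₂ ρ hρ (lt_of_lt_of_le hρlt (min_le_right _ _))
  rw [Filter.eventually_atTop] at E₁ E₂ ⊢
  obtain ⟨N₁, hN₁⟩ := E₁
  obtain ⟨N₂, hN₂⟩ := E₂
  refine ⟨max N₁ N₂, fun M hM => ?_⟩
  have hM₁ := hN₁ M (le_of_max_le_left hM)
  have hM₂ := hN₂ M (le_of_max_le_right hM)
  intro L a c κ Φ Z mode kn occ pair j S hS t ht
  -- positivity bookkeeping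
  have hL : 0 < L := by
    show 0 < sideLength ρ (M + 2)
    unfold sideLength
    positivity
  have hc : 0 ≤ c := Real.sqrt_nonneg _
  have hκ : 0 ≤ κ := Real.sqrt_nonneg _
  set k : ℝ := κ * 2⁻¹ ^ j with hk_def
  have hk : 0 ≤ k := mul_nonneg hκ (pow_nonneg (by norm_num) j)
  have hkκ : k ≤ κ := mul_le_of_le_one_right hκ (pow_le_one₀ (by norm_num) (by norm_num))
  have hck : 0 ≤ (c * k)⁻¹ := inv_nonneg.2 (mul_nonneg hc hk)
  ------------------------------------------------------------------
  -- the variance half: stub B with `C₂ ≤ C`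
  ------------------------------------------------------------------
  have hthr₂ : C₂ * (c * k)⁻¹ ≤ t :=
    le_trans (mul_le_mul_of_nonneg_right (le_max_right (54 * C₁) C₂) hck) ht
  have hvar : occ S t + pair S t ≤ occ S t ^ 2 + ENNReal.ofReal (C₂ * L ^ 3 * c ^ 2 * k) :=
    hM₂ j S hS t hthr₂
  have hbound₂ : ENNReal.ofReal (C₂ * L ^ 3 * c ^ 2 * k) ≤
      ENNReal.ofReal (max (54 * C₁) C₂ * L ^ 3 * c ^ 2 * k) := by
    apply ENNReal.ofReal_le_ofReal
    have hnn : 0 ≤ L ^ 3 * c ^ 2 * k := by positivity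
    calc C₂ * L ^ 3 * c ^ 2 * k = C₂ * (L ^ 3 * c ^ 2 * k) := by ring
      _ ≤ max (54 * C₁) C₂ * (L ^ 3 * c ^ 2 * k) :=
          mul_le_mul_of_nonneg_right (le_max_right _ _) hnn
      _ = max (54 * C₁) C₂ * L ^ 3 * c ^ 2 * k := by ring
  ------------------------------------------------------------------
  -- the occupation half: stub A mode by mode, then the lattice count
  ------------------------------------------------------------------
  -- per-mode bound for the modes of the shell (the `k = 0` shell is empty)
  have hper : ∀ n ∈ S,
      cellOccupation (M + 2) L (mode n) (fun X => ((Φ t X).toReal : ℂ)) / Z t ≤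
        ENNReal.ofReal (2 * C₁ * c / k) := by
    intro n hn
    obtain ⟨hn1, hn2⟩ := hS n hn
    have hknpos : 0 < kn n := lt_of_le_of_lt (by positivity) hn1
    rcases hk.eq_or_lt with hk0 | hkpos
    · exfalso
      rw [← hk0] at hn2
      linarith
    · have hknκ : kn n ≤ κ := hn2.trans hkκ
      have hthr₁ : C₁ * (c * kn n)⁻¹ ≤ t := by
        refine le_trans ?_ ht
        rcases hc.eq_or_lt with hc0 | hcpos
        · rw [← hc0]
          simp
        · have h1 : (c * kn n)⁻¹ ≤ 2 * (c * k)⁻¹ := by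
            have h2 : (c * kn n)⁻¹ ≤ (c * (k / 2))⁻¹ :=
              inv_anti₀ (by positivity) (mul_le_mul_of_nonneg_left hn1.le hc)
            have e : (c * (k / 2))⁻¹ = 2 * (c * k)⁻¹ := by
              rw [← mul_div_assoc, inv_div, div_eq_mul_inv]
            exact h2.trans_eq e
          calc C₁ * (c * kn n)⁻¹ ≤ C₁ * (2 * (c * k)⁻¹) := mul_le_mul_of_nonneg_left h1 hC₁.le
            _ = (2 * C₁) * (c * k)⁻¹ := by ring
            _ ≤ max (54 * C₁) C₂ * (c * k)⁻¹ := by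
                apply mul_le_mul_of_nonneg_right _ hck
                exact le_trans (by linarith) (le_max_left _ _)
      have h := hM₁ n hknpos hknκ t hthr₁
      have h' : cellOccupation (M + 2) L (mode n) (fun X => ((Φ t X).toReal : ℂ)) / Z t ≤
          ENNReal.ofReal (C₁ * c / kn n) := by
        simpa only [Finset.sum_singleton] using h
      refine h'.trans (ENNReal.ofReal_le_ofReal ?_)
      calc C₁ * c / kn n ≤ C₁ * c / (k / 2) :=
            div_le_div_of_nonneg_left (mul_nonneg hC₁.le hc) (by positivity) hn1.le
        _ = 2 * C₁ * c / k := by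
            rw [div_div_eq_mul_div]
            ring
  -- `⟨N_S⟩` is the sum of the per-mode occupations
  have hocc_eq : occ S t =
      ∑ n ∈ S, cellOccupation (M + 2) L (mode n) (fun X => ((Φ t X).toReal : ℂ)) / Z t := by
    show (∑ n ∈ S, cellOccupation (M + 2) L (mode n) (fun X => ((Φ t X).toReal : ℂ))) / Z t = _
    simp only [div_eq_mul_inv, Finset.sum_mul]
  have hsum : occ S t ≤ (S.card : ℝ≥0∞) * ENNReal.ofReal (2 * C₁ * c / k) := by
    rw [hocc_eq]
    calc ∑ n ∈ S, cellOccupation (M + 2) L (mode n) (fun X => ((Φ t X).toReal : ℂ)) / Z t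
        ≤ ∑ n ∈ S, ENNReal.ofReal (2 * C₁ * c / k) := Finset.sum_le_sum hper
      _ = (S.card : ℝ≥0∞) * ENNReal.ofReal (2 * C₁ * c / k) := by
          rw [Finset.sum_const, nsmul_eq_mul]
  -- shell geometry: the modes of `S` are nonzero lattice points of length `≤ L k / (2π) ≤ L k`
  have hgeom : ∀ n ∈ S, n ≠ 0 ∧ Real.sqrt (∑ i : Fin 3, ((n i : ℤ) : ℝ) ^ 2) ≤ L * k := by
    intro n hn
    obtain ⟨hn1, hn2⟩ := hS n hn
    have hknpos : 0 < kn n := lt_of_le_of_lt (by positivity) hn1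
    have hkn_def : kn n = 2 * Real.pi * Real.sqrt (∑ i : Fin 3, ((n i : ℤ) : ℝ) ^ 2) / L := rfl
    refine ⟨?_, ?_⟩
    · rintro rfl
      have h0 : kn 0 = 0 := by
        show 2 * Real.pi * Real.sqrt (∑ i : Fin 3, (((0 : Fin 3 → ℤ) i : ℤ) : ℝ) ^ 2) / L = 0
        simp
      linarith
    · rw [hkn_def, div_le_iff₀ hL] at hn2
      have hs0 : 0 ≤ Real.sqrt (∑ i : Fin 3, ((n i : ℤ) : ℝ) ^ 2) := Real.sqrt_nonneg _
      nlinarith [Real.pi_gt_three, hs0]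
  have hcardR : (S.card : ℝ) ≤ 27 * (L * k) ^ 3 := card_le_of_norm_le (by positivity) hgeom
  -- the real-number bookkeeping `27 (Lk)³ · 2C₁c/k ≤ C L³ c k²`
  have hreal : (27 * (L * k) ^ 3) * (2 * C₁ * c / k) ≤ max (54 * C₁) C₂ * L ^ 3 * c * k ^ 2 := by
    rcases hk.eq_or_lt with hk0 | hkpos
    · rw [← hk0]
      simp
    · have hk' : k ≠ 0 := hkpos.ne'
      have e : (27 * (L * k) ^ 3) * (2 * C₁ * c / k) = (54 * C₁) * (L ^ 3 * c * k ^ 2) := by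
        field_simp
        ring
      rw [e]
      have hnn : 0 ≤ L ^ 3 * c * k ^ 2 := by positivity
      calc (54 * C₁) * (L ^ 3 * c * k ^ 2) ≤ max (54 * C₁) C₂ * (L ^ 3 * c * k ^ 2) :=
            mul_le_mul_of_nonneg_right (le_max_left _ _) hnn
        _ = max (54 * C₁) C₂ * L ^ 3 * c * k ^ 2 := by ring
  have hoccBound : occ S t ≤ ENNReal.ofReal (max (54 * C₁) C₂ * L ^ 3 * c * k ^ 2) :=
    calc occ S t ≤ (S.card : ℝ≥0∞) * ENNReal.ofReal (2 * C₁ * c / k) := hsum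
      _ ≤ ENNReal.ofReal (27 * (L * k) ^ 3) * ENNReal.ofReal (2 * C₁ * c / k) := by
          gcongr
          rw [← ENNReal.ofReal_natCast]
          exact ENNReal.ofReal_le_ofReal hcardR
      _ = ENNReal.ofReal ((27 * (L * k) ^ 3) * (2 * C₁ * c / k)) :=
          (ENNReal.ofReal_mul (by positivity)).symm
      _ ≤ ENNReal.ofReal (max (54 * C₁) C₂ * L ^ 3 * c * k ^ 2) := ENNReal.ofReal_le_ofReal hreal
  exact ⟨hoccBound, hvar.trans (add_le_add le_rfl hbound₂)⟩

/-- Wiring check (an `example`, so that `SoftShellRelaxation_of` stays the only theorem concluding the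
crux): the registered stubs feed the skeleton theorem as stated — this term becomes the crux proof when
the two `sorry`s above are discharged (it carries `sorryAx` exactly through the two `stub_*`). -/
example : Summit.AtomisticToContinuum.BoseEinsteinCondensation.Theses.BECCovarianceTransport.SoftShellRelaxation :=
  SoftShellRelaxation_of stub_modeOccupation stub_shellVariance

/-- The plain-arrow form `<stub sigs> → SoftShellRelaxation` of the skeleton theorem (same proof term). -/
example : ModeOccupationLaw → ShellVarianceLaw →
    Summit.AtomisticToContinuum.BoseEinsteinCondensation.Theses.BECCovarianceTransport.SoftShellRelaxation :=
  SoftShellRelaxation_of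

end Summit.AtomisticToContinuum.BoseEinsteinCondensation.Cruxes.SoftShellRelaxation.Birth

end
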